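import Summits.KontsevichZagierPeriods.KontsevichZagierPeriods.Theorems.SoloBlindTriplPrep
import Summits.KontsevichZagierPeriods.KontsevichZagierPeriods.Theorems.SoloBlindLevelLinear
import HarnessLib

/-!
# Triplication, II: the first-kind Gauss-triplication shadows are Kontsevich–Zagier chains

With the nested-radical substitution `Ψ(u) = (1 - (1-u)^{1/3})³/u` of `SoloBlindTriplPrep` we
perform, inside the three Kontsevich–Zagier rules (additivity, algebraic change of variables,
Newton–Leibniz — here only the first two are needed), the chain

  `β(a,b)  —(subst t = Ψ(u))→  [(0,1), 3^{b-1}(h₁ ± h₂)]  —(integrand additivity)→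
      3^{b-1} • ([(0,1), h₁] ± [(0,1), h₂])`,

`hᵢ` Beta integrands, and obtain in `Q = (FormalRep ⧸ ⟨rules⟩)`:

* `betaQ_tripl0`: for rational `a, b > 0` with `3a + b = 1`,
  `β(a,b) = 3^{b-1} • (β(2a, b/3) + β(2a, (b+1)/3))`;
* `betaQ_tripl1`: for rational `a > 1/2`, `b > 0` with `3a + b = 2`,
  `β(a,b) = 3^{b-1} • (β(2a-1, b/3) - β(2a-1, (b+2)/3))`.

In both cases the two classes on the right lie in ONE `S₃`-orbit (`{2a, ⅓-a, ⅔-a}` resp.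
`{2a-1, ⅔-a, 4/3-a}`), so by the cyclic relation they are proportional with a coefficient
`sin(π(⅓-a))/sin(π(⅔-a)) > 0` resp. `sin(π(⅔-a))/sin(π(4/3-a)) < 1`; hence the orbit of
`{a, 2a, 1-3a}` MERGES with the orbit of `{2a, ⅓-a, ⅔-a}` (`betaQ_propTo_tripl0`) and the orbit of
`{a, 2a-1, 2-3a}` with that of `{2a-1, ⅔-a, 4/3-a}` (`betaQ_propTo_tripl1`). At level `9` these are
exactly the three Deligne–Koblitz–Ogus coincidences of the first kind
(`{2,3,4} ~ {1,4,4}`, `{1,2,6} ~ {2,2,5}`, `{1,3,5} ~ {1,1,7}`), which no relation of level `≤ 8`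
produces: the period values read `B(2/9,1/3) = 3^{-2/3}(B(4/9,1/9) + B(4/9,4/9))` etc.

References: N. Aoki, T. Shioda, *Generators of the Néron–Severi group of a Fermat surface* (1983),
Thm. 2 (the curves `w³ = c·xyz`); J. Wolfart, G. Wüstholz, *Der Überlagerungsradius gewisser
algebraischer Kurven und die Werte der Betafunktion an rationalen Stellen*, Math. Ann. 273 (1985).
-/

noncomputable section

open Set MeasureTheory MvPolynomial

namespace Summit.KontsevichZagierPeriods.KontsevichZagierPeriods.Theorems

namespace SoloBlind

open Literature.ModelTheory.ExponentialFields (IsSemialgebraic)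
open Literature.NumberTheory.Transcendental
open Literature.NumberTheory.Transcendental.KZ
open Literature.Analysis.SpecialFunctions.Selberg

/-! ## The coefficient `3^{b-1}` -/

/-- `3^{b-1}` as an element of `K₀ = ℚ̄ ∩ ℝ`. -/
def triCoeff (b : ℚ) : K₀ := ⟨(3:ℝ) ^ ((b : ℝ) - 1), mem_K₀_iff.mpr (tri_coeff_isAlgebraic b)⟩

/-- `(triCoeff b : ℝ) = 3^{b-1}`. -/
theorem coe_triCoeff (b : ℚ) : ((triCoeff b : K₀) : ℝ) = (3:ℝ) ^ ((b : ℝ) - 1) := rfl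

/-- `3^{b-1} ≠ 0`. -/
theorem triCoeff_ne_zero (b : ℚ) : triCoeff b ≠ 0 := by
  intro h
  have h' := congrArg (fun z : K₀ => (z : ℝ)) h
  simp only [coe_triCoeff, ZeroMemClass.coe_zero] at h'
  have : (0:ℝ) < (3:ℝ) ^ ((b : ℝ) - 1) := by positivity
  linarith

/-! ## The representations -/

/-- Source for `3a+b=1`: `[(0,1), 3^{b-1}(h₁ + h₂)]`. -/
def triSrc0 (a b : ℚ) (ha : 0 < a) (hb : 0 < b) : IntegralRep 1 :=
  lineRep (Ioo 0 1) (triF0 a b) mix_line_sa (isSemialgebraicFunOn_triF0 a b ha hb)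
    (integrableOn_triF0 a b ha hb)

/-- Inner sum for `3a+b=1`: `[(0,1), h₁ + h₂]`. -/
def triInner0 (a b : ℚ) (ha : 0 < a) (hb : 0 < b) : IntegralRep 1 :=
  lineRep (Ioo 0 1) (fun u => betaFun (2 * a) (b / 3) u + betaFun (2 * a) ((b + 1) / 3) u)
    mix_line_sa
    (IsSemialgebraicFunOn.add_holds
      (isSemialgebraicFunOn_betaFun (2 * a) (b / 3) (by positivity) (by positivity))
      (isSemialgebraicFunOn_betaFun (2 * a) ((b + 1) / 3) (by positivity) (by positivity)))
    ((integrableOn_betaFun (2 * a) (b / 3) (by positivity) (by positivity)).add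
      (integrableOn_betaFun (2 * a) ((b + 1) / 3) (by positivity) (by positivity)))

/-- Source for `3a+b=2`: `[(0,1), 3^{b-1}(h₁ - h₂)]`. -/
def triSrc1 (a b : ℚ) (ha : 1 / 2 < a) (hb : 0 < b) : IntegralRep 1 :=
  lineRep (Ioo 0 1) (triF1 a b) mix_line_sa (isSemialgebraicFunOn_triF1 a b ha hb)
    (integrableOn_triF1 a b ha hb)

/-- Inner difference for `3a+b=2`: `[(0,1), h₁ - h₂]`. -/
def triInner1 (a b : ℚ) (ha : 1 / 2 < a) (hb : 0 < b) : IntegralRep 1 :=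
  lineRep (Ioo 0 1)
    (fun u => betaFun (2 * a - 1) (b / 3) u - betaFun (2 * a - 1) ((b + 2) / 3) u) mix_line_sa
    (IsSemialgebraicFunOn.sub_holds
      (isSemialgebraicFunOn_betaFun (2 * a - 1) (b / 3) (by linarith) (by positivity))
      (isSemialgebraicFunOn_betaFun (2 * a - 1) ((b + 2) / 3) (by linarith) (by positivity)))
    ((integrableOn_betaFun (2 * a - 1) (b / 3) (by linarith) (by positivity)).sub
      (integrableOn_betaFun (2 * a - 1) ((b + 2) / 3) (by linarith) (by positivity)))

/-- The source is `3^{b-1}` times the inner sum, literally. -/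
theorem triSrc0_eq (a b : ℚ) (ha : 0 < a) (hb : 0 < b) :
    triSrc0 a b ha hb = (triInner0 a b ha hb).constMul ((3:ℝ) ^ ((b : ℝ) - 1))
      (tri_coeff_isAlgebraic b) :=
  IntegralRep.ext' rfl rfl

/-- The source is `3^{b-1}` times the inner difference, literally. -/
theorem triSrc1_eq (a b : ℚ) (ha : 1 / 2 < a) (hb : 0 < b) :
    triSrc1 a b ha hb = (triInner1 a b ha hb).constMul ((3:ℝ) ^ ((b : ℝ) - 1))
      (tri_coeff_isAlgebraic b) :=
  IntegralRep.ext' rfl rfl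

/-! ## The moves -/

/-- **Move 1 (`3a+b=1`), the substitution `t = Ψ(u)`: `[(0,1), 3^{b-1}(h₁+h₂)] ≡ β(a,b)`.** -/
theorem triSrc0_sub_betaRep (a b : ℚ) (ha : 0 < a) (hb : 0 < b) (h : 3 * a + b = 1) :
    of (triSrc0 a b ha hb) - of (betaRep a b ha hb) ∈ relations := by
  unfold triSrc0 betaRep
  exact lineRep_subst triPsi triPsi' isSemialgebraicFunOn_triPsi
    (fun t ht => (hasDerivAt_triPsi ht.2).hasDerivWithinAt) injOn_triPsi image_triPsi
    (fun t ht => tri_pullback0 a b h ht)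

/-- **Move 1 (`3a+b=2`), the substitution `t = Ψ(u)`: `[(0,1), 3^{b-1}(h₁-h₂)] ≡ β(a,b)`.** -/
theorem triSrc1_sub_betaRep (a b : ℚ) (ha : 1 / 2 < a) (hb : 0 < b) (h : 3 * a + b = 2) :
    of (triSrc1 a b ha hb) - of (betaRep a b (one_half_pos.trans ha) hb) ∈ relations := by
  unfold triSrc1 betaRep
  exact lineRep_subst triPsi triPsi' isSemialgebraicFunOn_triPsi
    (fun t ht => (hasDerivAt_triPsi ht.2).hasDerivWithinAt) injOn_triPsi image_triPsi
    (fun t ht => tri_pullback1 a b h ht)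

/-- **Move 2 (`3a+b=1`), integrand additivity: `[(0,1), h₁+h₂] ≡ [(0,1),h₁] + [(0,1),h₂]`.** -/
theorem triInner0_sub_sub (a b : ℚ) (ha : 0 < a) (hb : 0 < b) (ha' : 0 < 2 * a)
    (hb' : 0 < b / 3) (hb'' : 0 < (b + 1) / 3) :
    of (triInner0 a b ha hb) - of (betaRep (2 * a) (b / 3) ha' hb')
      - of (betaRep (2 * a) ((b + 1) / 3) ha' hb'') ∈ relations :=
  of_sub_sub_mem_relations_of_add rfl rfl fun _ _ => rfl

/-- **Move 2 (`3a+b=2`), integrand additivity, written as `h₁ = (h₁ - h₂) + h₂`.** -/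
theorem triInner1_sub_sub (a b : ℚ) (ha : 1 / 2 < a) (hb : 0 < b) (ha' : 0 < 2 * a - 1)
    (hb' : 0 < b / 3) (hb'' : 0 < (b + 2) / 3) :
    of (betaRep (2 * a - 1) (b / 3) ha' hb') - of (triInner1 a b ha hb)
      - of (betaRep (2 * a - 1) ((b + 2) / 3) ha' hb'') ∈ relations :=
  -- (the domain equality of the two Beta representations is routed through `betaRep_domain`:
  -- a direct `rfl` makes the kernel compare the exponents `b/3`, `(b+2)/3` and time out)
  of_sub_sub_mem_relations_of_add rfl (betaRep_domain.trans betaRep_domain.symm) fun x _ => by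
    have e₀ : (betaRep (2 * a - 1) (b / 3) ha' hb').integrand x =
        betaFun (2 * a - 1) (b / 3) (x 0) := rfl
    have e₁ : (triInner1 a b ha hb).integrand x =
        betaFun (2 * a - 1) (b / 3) (x 0) - betaFun (2 * a - 1) ((b + 2) / 3) (x 0) := rfl
    have e₂ : (betaRep (2 * a - 1) ((b + 2) / 3) ha' hb'').integrand x =
        betaFun (2 * a - 1) ((b + 2) / 3) (x 0) := rfl
    rw [e₀, e₁, e₂]
    ring

/-! ## Triplication in `Q` -/

/-- **First-kind triplication, `3a + b = 1`:
`β(a,b) = 3^{b-1} • (β(2a, b/3) + β(2a, (b+1)/3))` inside the Kontsevich–Zagier rules.** -/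
theorem betaQ_tripl0 (a b : ℚ) (ha : 0 < a) (hb : 0 < b) (h : 3 * a + b = 1) :
    betaQ a b = triCoeff b • (betaQ (2 * a) (b / 3) + betaQ (2 * a) ((b + 1) / 3)) := by
  have ha' : (0:ℚ) < 2 * a := by positivity
  have hb' : (0:ℚ) < b / 3 := by positivity
  have hb'' : (0:ℚ) < (b + 1) / 3 := by positivity
  have h1 : mkQ (of (betaRep a b ha hb)) = mkQ (of (triSrc0 a b ha hb)) :=
    (mkQ_eq_mkQ_iff.mpr (triSrc0_sub_betaRep a b ha hb h)).symm
  have h2 : mkQ (of (triInner0 a b ha hb)) = mkQ (of (betaRep (2 * a) (b / 3) ha' hb'))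
      + mkQ (of (betaRep (2 * a) ((b + 1) / 3) ha' hb'')) := by
    rw [← map_add, mkQ_eq_mkQ_iff]
    have h := triInner0_sub_sub a b ha hb ha' hb' hb''
    rwa [sub_sub] at h
  have h3 : mkQ (of (triSrc0 a b ha hb)) = triCoeff b • mkQ (of (triInner0 a b ha hb)) := by
    rw [triSrc0_eq, mkQ_constMul]
    rfl
  rw [betaQ_eq ha hb, h1, h3, h2, betaQ_eq ha' hb', betaQ_eq ha' hb'']

/-- **First-kind triplication, `3a + b = 2`:
`β(a,b) = 3^{b-1} • (β(2a-1, b/3) - β(2a-1, (b+2)/3))` inside the Kontsevich–Zagier rules.** -/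
theorem betaQ_tripl1 (a b : ℚ) (ha : 1 / 2 < a) (hb : 0 < b) (h : 3 * a + b = 2) :
    betaQ a b = triCoeff b • (betaQ (2 * a - 1) (b / 3) - betaQ (2 * a - 1) ((b + 2) / 3)) := by
  have ha0 : (0:ℚ) < a := one_half_pos.trans ha
  have ha' : (0:ℚ) < 2 * a - 1 := by linarith
  have hb' : (0:ℚ) < b / 3 := by positivity
  have hb'' : (0:ℚ) < (b + 2) / 3 := by positivity
  have h1 : mkQ (of (betaRep a b ha0 hb)) = mkQ (of (triSrc1 a b ha hb)) :=
    (mkQ_eq_mkQ_iff.mpr (triSrc1_sub_betaRep a b ha hb h)).symm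
  have h2 : mkQ (of (triInner1 a b ha hb)) = mkQ (of (betaRep (2 * a - 1) (b / 3) ha' hb'))
      - mkQ (of (betaRep (2 * a - 1) ((b + 2) / 3) ha' hb'')) := by
    rw [eq_sub_iff_add_eq, ← map_add, mkQ_eq_mkQ_iff]
    have h := triInner1_sub_sub a b ha hb ha' hb' hb''
    rw [sub_sub] at h
    exact (mkQ_eq_mkQ_iff.mp ((mkQ_eq_mkQ_iff.mpr h).symm))
  have h3 : mkQ (of (triSrc1 a b ha hb)) = triCoeff b • mkQ (of (triInner1 a b ha hb)) := by
    rw [triSrc1_eq, mkQ_constMul]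
    rfl
  rw [betaQ_eq ha0 hb, h1, h3, h2, betaQ_eq ha' hb', betaQ_eq ha' hb'']

/-- Period check (`3a+b=1`): `B(a,b) = 3^{b-1}(B(2a,b/3) + B(2a,(b+1)/3))`. -/
theorem beta_tripl0_value (a b : ℚ) (ha : 0 < a) (hb : 0 < b) (h : 3 * a + b = 1) :
    evalQ (betaQ a b) = (3:ℝ) ^ ((b : ℝ) - 1) *
      (evalQ (betaQ (2 * a) (b / 3)) + evalQ (betaQ (2 * a) ((b + 1) / 3))) := by
  rw [betaQ_tripl0 a b ha hb h, evalQ_smul, coe_triCoeff, map_add]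

/-- Period check (`3a+b=2`): `B(a,b) = 3^{b-1}(B(2a-1,b/3) - B(2a-1,(b+2)/3))`. -/
theorem beta_tripl1_value (a b : ℚ) (ha : 1 / 2 < a) (hb : 0 < b) (h : 3 * a + b = 2) :
    evalQ (betaQ a b) = (3:ℝ) ^ ((b : ℝ) - 1) *
      (evalQ (betaQ (2 * a - 1) (b / 3)) - evalQ (betaQ (2 * a - 1) ((b + 2) / 3))) := by
  rw [betaQ_tripl1 a b ha hb h, evalQ_smul, coe_triCoeff, map_sub]

/-! ## The orbit merges -/

/-- In an `S₃`-orbit `{A, B, C}`, `A + B + C = 1`: `sin(πC) • β(A,C) = sin(πB) • β(A,B)`. -/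
theorem orbit_pair (A B C : ℚ) (hA : 0 < A) (hB : 0 < B) (hC : 0 < C) (h : A + B + C = 1) :
    sinQ C • betaQ A C = sinQ B • betaQ A B := by
  have h1 := betaQ_cyclic_rat B C hB hC (by linarith)
  rw [show 1 - B - C = A by linarith, betaQ_symm hB hA, betaQ_symm hC hA] at h1
  exact h1.symm

/-- `sin(πp) + sin(πq) ≠ 0` for `p, q ∈ (0,1)`. -/
theorem sinQ_add_sinQ_ne_zero {p q : ℚ} (hp0 : 0 < p) (hp1 : p < 1) (hq0 : 0 < q) (hq1 : q < 1) :
    sinQ p + sinQ q ≠ 0 := by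
  intro h
  have h' := congrArg (fun z : K₀ => (z : ℝ)) h
  simp only [AddMemClass.coe_add, sinQ_val, ZeroMemClass.coe_zero] at h'
  have hp : (0:ℝ) < p := by exact_mod_cast hp0
  have hp' : (p:ℝ) < 1 := by exact_mod_cast hp1
  have hq : (0:ℝ) < q := by exact_mod_cast hq0
  have hq' : (q:ℝ) < 1 := by exact_mod_cast hq1
  have h1 := Real.sin_pos_of_pos_of_lt_pi (mul_pos Real.pi_pos hp) (by nlinarith [Real.pi_pos])
  have h2 := Real.sin_pos_of_pos_of_lt_pi (mul_pos Real.pi_pos hq) (by nlinarith [Real.pi_pos])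
  linarith

/-- `sin(πq) - sin(πp) ≠ 0` for `0 < p < 1 - q < 1/2` (then `sin(πp) < sin(π(1-q)) = sin(πq)`). -/
theorem sinQ_sub_sinQ_ne_zero {p q : ℚ} (hp0 : 0 < p) (hpq : p < 1 - q) (hq : 1 / 2 < q) :
    sinQ q - sinQ p ≠ 0 := by
  intro h
  have h' := congrArg (fun z : K₀ => (z : ℝ)) h
  simp only [AddSubgroupClass.coe_sub, sinQ_val, ZeroMemClass.coe_zero] at h'
  have hp : (0:ℝ) < p := by exact_mod_cast hp0
  have hpq' : (p:ℝ) < 1 - q := by exact_mod_cast hpq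
  have hq' : (1:ℝ) / 2 < q := by
    rw [show (1:ℝ) / 2 = ((1 / 2 : ℚ) : ℝ) by norm_num]; exact_mod_cast hq
  have hπ := Real.pi_pos
  have hlt : Real.sin (Real.pi * p) < Real.sin (Real.pi * q) := by
    rw [← Real.sin_pi_sub (Real.pi * q), show Real.pi - Real.pi * q = Real.pi * (1 - q) by ring]
    exact Real.strictMonoOn_sin ⟨by nlinarith, by nlinarith⟩ ⟨by nlinarith, by nlinarith⟩
      (by nlinarith)
  linarith

/-- **Triplication merge (`3a+b=1`): `β(a, 1-3a) ≐ β(2a, ⅓-a)`** — the orbit of `{a, 2a, 1-3a}`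
merges with the orbit of `{2a, ⅓-a, ⅔-a}`, for rational `0 < a < 1/3`. -/
theorem betaQ_propTo_tripl0 (a : ℚ) (ha : 0 < a) (ha3 : 3 * a < 1) :
    PropTo (betaQ a (1 - 3 * a)) (betaQ (2 * a) (1 / 3 - a)) := by
  have key := betaQ_tripl0 a (1 - 3 * a) ha (by linarith) (by ring)
  rw [show (1 - 3 * a) / 3 = 1 / 3 - a by ring, show (1 - 3 * a + 1) / 3 = 2 / 3 - a by ring]
    at key
  have hp := orbit_pair (2 * a) (1 / 3 - a) (2 / 3 - a) (by positivity) (by linarith)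
    (by linarith) (by ring)
  refine PropTo.of_smul_eq_smul (c := sinQ (2 / 3 - a))
    (c' := triCoeff (1 - 3 * a) * (sinQ (2 / 3 - a) + sinQ (1 / 3 - a)))
    (sinQ_ne_zero (by linarith) (by linarith))
    (mul_ne_zero (triCoeff_ne_zero _)
      (sinQ_add_sinQ_ne_zero (by linarith) (by linarith) (by linarith) (by linarith))) ?_
  rw [key, smul_smul, mul_comm, ← smul_smul, smul_add, hp, ← add_smul, smul_smul]

/-- **Triplication merge (`3a+b=2`): `β(a, 2-3a) ≐ β(2a-1, ⅔-a)`** — the orbit of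
`{a, 2a-1, 2-3a}` merges with the orbit of `{2a-1, ⅔-a, 4/3-a}`, for rational `1/2 < a < 2/3`. -/
theorem betaQ_propTo_tripl1 (a : ℚ) (ha : 1 / 2 < a) (ha3 : 3 * a < 2) :
    PropTo (betaQ a (2 - 3 * a)) (betaQ (2 * a - 1) (2 / 3 - a)) := by
  have key := betaQ_tripl1 a (2 - 3 * a) ha (by linarith) (by ring)
  rw [show (2 - 3 * a) / 3 = 2 / 3 - a by ring, show (2 - 3 * a + 2) / 3 = 4 / 3 - a by ring]
    at key
  have hp := orbit_pair (2 * a - 1) (2 / 3 - a) (4 / 3 - a) (by linarith) (by linarith)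
    (by linarith) (by ring)
  refine PropTo.of_smul_eq_smul (c := sinQ (4 / 3 - a))
    (c' := triCoeff (2 - 3 * a) * (sinQ (4 / 3 - a) - sinQ (2 / 3 - a)))
    (sinQ_ne_zero (by linarith) (by linarith))
    (mul_ne_zero (triCoeff_ne_zero _)
      (sinQ_sub_sinQ_ne_zero (by linarith) (by linarith) (by linarith))) ?_
  rw [key, smul_smul, mul_comm, ← smul_smul, smul_sub, hp, ← sub_smul, smul_smul]

/-! ## Level `9`: the three first-kind Deligne–Koblitz–Ogus coincidences -/

/-- `β(2/9,1/3) = 3^{-2/3} • (β(4/9,1/9) + β(4/9,4/9))` — `{2,3,4}` meets `{1,4,4}`. -/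
theorem betaQ_tripl_nine_234 :
    betaQ (2 / 9) (1 / 3) = triCoeff (1 / 3) • (betaQ (4 / 9) (1 / 9) + betaQ (4 / 9) (4 / 9)) := by
  have h := betaQ_tripl0 (2 / 9) (1 / 3) (by norm_num) (by norm_num) (by norm_num)
  norm_num at h
  rwa [← smul_add] at h

/-- `β(1/9,2/3) = 3^{-1/3} • (β(2/9,2/9) + β(2/9,5/9))` — `{1,2,6}` meets `{2,2,5}`. -/
theorem betaQ_tripl_nine_126 :
    betaQ (1 / 9) (2 / 3) = triCoeff (2 / 3) • (betaQ (2 / 9) (2 / 9) + betaQ (2 / 9) (5 / 9)) := by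
  have h := betaQ_tripl0 (1 / 9) (2 / 3) (by norm_num) (by norm_num) (by norm_num)
  norm_num at h
  rwa [← smul_add] at h

/-- `β(5/9,1/3) = 3^{-2/3} • (β(1/9,1/9) - β(1/9,7/9))` — `{1,3,5}` meets `{1,1,7}`. -/
theorem betaQ_tripl_nine_135 :
    betaQ (5 / 9) (1 / 3) = triCoeff (1 / 3) • (betaQ (1 / 9) (1 / 9) - betaQ (1 / 9) (7 / 9)) := by
  have h := betaQ_tripl1 (5 / 9) (1 / 3) (by norm_num) (by norm_num) (by norm_num)
  norm_num at h
  exact h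

/-- `β(2/9,1/3) ≐ β(4/9,1/9)`. -/
theorem betaQ_propTo_nine_234 : PropTo (betaQ (2 / 9) (1 / 3)) (betaQ (4 / 9) (1 / 9)) := by
  have h := betaQ_propTo_tripl0 (2 / 9) (by norm_num) (by norm_num)
  norm_num at h
  exact h

/-- `β(1/9,2/3) ≐ β(2/9,2/9)`. -/
theorem betaQ_propTo_nine_126 : PropTo (betaQ (1 / 9) (2 / 3)) (betaQ (2 / 9) (2 / 9)) := by
  have h := betaQ_propTo_tripl0 (1 / 9) (by norm_num) (by norm_num)
  norm_num at h
  exact h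

/-- `β(5/9,1/3) ≐ β(1/9,1/9)`. -/
theorem betaQ_propTo_nine_135 : PropTo (betaQ (5 / 9) (1 / 3)) (betaQ (1 / 9) (1 / 9)) := by
  have h := betaQ_propTo_tripl1 (5 / 9) (by norm_num) (by norm_num)
  norm_num at h
  exact h

end SoloBlind

end Summit.KontsevichZagierPeriods.KontsevichZagierPeriods.Theorems
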